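import Literature.Barriers.ABC.BakerMethodBoundsStewartYu1991KummerProofs
import HarnessLib

/-!
# Cell abc-stewartyu, WP-Y2 / `TwoAdicPrincipalCubic`: the multicubic algebra `ℚ(∛α₁, …, ∛αₖ)`
# inside an arbitrary field of characteristic zero (I: evaluation, convolution, independence, slices)

`Summits/ABC/StewartYu/PadicMulticubic.lean` — cell `abc-stewartyu` (HOME
`run/shared/lean/pub/abc-stewartyu/`, lit seat g3; theorems and plain definitions only, no named
fact). The `q = 3` twin of `PadicMultiquadratic.lean` (seat p3): at the THIRD points of a
`3`-descent (Yu 1990 §2 with `q = 3`; the cell's `2`-adic engine `TwoAdicPrincipalCubic` of route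
`PadicPrimesYuNinety`, crux `YuNinetyTwo`, generators `αⱼ = qⱼ²`, cube roots in `ℤ₂` by Hensel —
`Literature.NumberTheory.LocalFields.padicInt_two_exists_cube_eq`) the values of the auxiliary
functions are `ℚ`-combinations of the `3ᵏ` monomials `∏ⱼ tⱼ^{λⱼ}`, `0 ≤ λⱼ < 3`, `tⱼ³ = αⱼ`
(Yu 1990 (2.110)). Namespace `Summit.ABC.StewartYu.Multicub`, any field `L` of characteristic zero:

* `mono3 t l = ∏ⱼ tⱼ^{lⱼ}` (`l : Fin k → Fin 3`), `ev3 t c = ∑_l c_l · mono3 t l`; linearity;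
* `mono3_mul_mono3`: `mono3 l · mono3 l' = (∏ⱼ αⱼ^{carry}) · mono3 (l + l')` (`carry = ⌊(lⱼ + l'ⱼ)/3⌋`),
  the convolution `cmul3 α c d`, `ev3_cmul3 : ev3 t (cmul3 α c d) = ev3 t c · ev3 t d`,
  `l1_cmul3_le`, `exists_int_cmul3` (sizes and denominators, integer generators);
* `linearIndependent_mono3` (= `Literature.Barriers.ABC.Multicubic.linearIndependent_prod_pow_of_cube_eq`
  over `ℚ`) under the `3`-Kummer condition "no `∏ αⱼ^{κⱼ}` with some `κⱼ ≢ 0 (mod 3)` is a rational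
  cube", `ev3_ne_zero`, `hind_init`;
* splitting off the last root: `slice c r` (`r : Fin 3`), `glue`, `ev3_succ`
  (`ev3 t c = A + t_k B + t_k² C` with `A, B, C` evaluations over the first `k` roots).

Sequels: `PadicMulticubicNorm.lean` (the norm to the previous floor `x · cof(x) = N(x)`, `N ≠ 0`,
sizes), `PadicMulticubicLiouville.lean` (the Liouville inequality at the third points in an
arbitrary ultrametric field). Everything is [folklore]; nothing here is claimed to be in print.
-/

noncomputable section

open Finset

namespace Summit.ABC.StewartYu

namespace Multicub

variable {L : Type*} [Field L] [CharZero L]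
variable {k : ℕ}

/-! ### Monomials and evaluation -/

/-- The monomial `∏ⱼ tⱼ^{lⱼ}`, `l : Fin k → Fin 3`, of a family of (cube) roots `t`. [folklore] -/
def mono3 (t : Fin k → L) (l : Fin k → Fin 3) : L := ∏ j, t j ^ (l j : ℕ)

/-- Evaluation of a rational coefficient vector on the `3ᵏ` monomials. [folklore] -/
def ev3 (t : Fin k → L) (c : (Fin k → Fin 3) → ℚ) : L := ∑ l, (c l : L) * mono3 t l

/-- `ev3` is additive. [folklore] -/
theorem ev3_add (t : Fin k → L) (c d : (Fin k → Fin 3) → ℚ) :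
    ev3 t (c + d) = ev3 t c + ev3 t d := by
  unfold ev3; rw [← Finset.sum_add_distrib]
  refine Finset.sum_congr rfl fun l _ => ?_
  rw [Pi.add_apply, Rat.cast_add, add_mul]

/-- `ev3` is `ℚ`-homogeneous. [folklore] -/
theorem ev3_smul (t : Fin k → L) (q : ℚ) (c : (Fin k → Fin 3) → ℚ) :
    ev3 t (q • c) = (q : L) * ev3 t c := by
  unfold ev3; rw [Finset.mul_sum]
  refine Finset.sum_congr rfl fun l _ => ?_
  rw [Pi.smul_apply, smul_eq_mul, Rat.cast_mul, mul_assoc]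

omit [CharZero L] in
/-- `ev3 t 0 = 0`. [folklore] -/
theorem ev3_zero (t : Fin k → L) : ev3 t 0 = 0 := by
  unfold ev3; simp

/-- `ev3` commutes with negation. [folklore] -/
theorem ev3_neg (t : Fin k → L) (c : (Fin k → Fin 3) → ℚ) : ev3 t (-c) = -ev3 t c := by
  have h := ev3_smul t (-1) c
  rw [neg_one_smul] at h
  rw [h]; push_cast; ring

/-- `ev3` commutes with subtraction. [folklore] -/
theorem ev3_sub (t : Fin k → L) (c d : (Fin k → Fin 3) → ℚ) :
    ev3 t (c - d) = ev3 t c - ev3 t d := by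
  rw [sub_eq_add_neg, ev3_add, ev3_neg, ← sub_eq_add_neg]

/-! ### Products of monomials and the convolution product -/

/-- The carry of the exponent addition mod `3`: `⌊(lⱼ + l'ⱼ)/3⌋ ∈ {0, 1}`. [folklore] -/
def carry (l l' : Fin k → Fin 3) (j : Fin k) : ℕ := ((l j : ℕ) + l' j) / 3

/-- Every carry is `0` or `1`. [folklore] -/
theorem carry_le_one (l l' : Fin k → Fin 3) (j : Fin k) : carry l l' j ≤ 1 := by
  unfold carry
  have h1 := (l j).2
  have h2 := (l' j).2
  omega

/-- `mono3 l · mono3 l' = (∏ⱼ αⱼ^{carryⱼ}) · mono3 (l + l')` when `tⱼ³ = αⱼ`. [folklore] -/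
theorem mono3_mul_mono3 (α : Fin k → ℚ) (t : Fin k → L) (ht : ∀ j, t j ^ 3 = (α j : L))
    (l l' : Fin k → Fin 3) :
    mono3 t l * mono3 t l' = ((∏ j, α j ^ carry l l' j : ℚ) : L) * mono3 t (l + l') := by
  unfold mono3
  rw [Rat.cast_prod, ← Finset.prod_mul_distrib, ← Finset.prod_mul_distrib]
  refine Finset.prod_congr rfl fun j _ => ?_
  rw [Rat.cast_pow, ← ht, ← pow_mul, ← pow_add, ← pow_add, Pi.add_apply, Fin.val_add]
  congr 1
  unfold carry
  omega

/-- The convolution product of coefficient vectors: `ev3 (cmul3 α c d) = ev3 c · ev3 d`. [folklore] -/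
def cmul3 (α : Fin k → ℚ) (c d : (Fin k → Fin 3) → ℚ) : (Fin k → Fin 3) → ℚ := fun l'' =>
  ∑ l, ∑ l', if l + l' = l'' then (∏ j, α j ^ carry l l' j) * (c l * d l') else 0

/-- **`ev3` is multiplicative for `cmul3`.** [folklore] -/
theorem ev3_cmul3 (α : Fin k → ℚ) (t : Fin k → L) (ht : ∀ j, t j ^ 3 = (α j : L))
    (c d : (Fin k → Fin 3) → ℚ) :
    ev3 t (cmul3 α c d) = ev3 t c * ev3 t d := by
  classical
  unfold ev3 cmul3
  rw [Finset.sum_mul_sum]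
  have lhs : ∑ l'', ((∑ l, ∑ l', (if l + l' = l'' then (∏ j, α j ^ carry l l' j) * (c l * d l')
      else 0) : ℚ) : L) * mono3 t l'' =
      ∑ l, ∑ l', ((∏ j, α j ^ carry l l' j : ℚ) : L) * ((c l : L) * (d l' : L)) *
        mono3 t (l + l') := by
    simp only [Rat.cast_sum, Finset.sum_mul]
    rw [Finset.sum_comm]
    refine Finset.sum_congr rfl fun l _ => ?_
    rw [Finset.sum_comm]
    refine Finset.sum_congr rfl fun l' _ => ?_
    rw [Finset.sum_eq_single (l + l')]
    · simp
    · intro l'' _ h; rw [if_neg (Ne.symm h)]; simp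
    · intro h; exact absurd (Finset.mem_univ _) h
  rw [lhs]
  refine Finset.sum_congr rfl fun l _ => Finset.sum_congr rfl fun l' _ => ?_
  have key := mono3_mul_mono3 α t ht l l'
  calc ((∏ j, α j ^ carry l l' j : ℚ) : L) * ((c l : L) * (d l' : L)) * mono3 t (l + l')
      = ((c l : L) * (d l' : L)) * (((∏ j, α j ^ carry l l' j : ℚ) : L) * mono3 t (l + l')) := by
        ring
    _ = ((c l : L) * (d l' : L)) * (mono3 t l * mono3 t l') := by rw [key]
    _ = (c l : L) * mono3 t l * ((d l' : L) * mono3 t l') := by ring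

/-! ### Linear independence of the monomials under the `3`-Kummer condition -/

/-- **The `3ᵏ` monomials are `ℚ`-linearly independent in `L`** when no `∏ αⱼ^{κⱼ}` with some
`κⱼ ≢ 0 (mod 3)` is a rational cube (lit's `Multicubic.linearIndependent_prod_pow_of_cube_eq`,
`K = ℚ`). [folklore] -/
theorem linearIndependent_mono3 {n : ℕ} (α : Fin n → ℚ)
    (hind : ∀ κ : Fin n → ℕ, (∃ j, ¬ 3 ∣ κ j) → ∀ γ : ℚ, ∏ j, α j ^ κ j ≠ γ ^ 3)
    (t : Fin n → L) (ht : ∀ j, t j ^ 3 = (α j : L)) :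
    LinearIndependent ℚ (fun l : Fin n → Fin 3 => mono3 t l) := by
  have h3 : (3 : L) ≠ 0 := by
    rw [show (3 : L) = algebraMap ℚ L 3 from (map_ofNat (algebraMap ℚ L) 3).symm]
    exact (_root_.map_ne_zero _).mpr three_ne_zero
  exact Literature.Barriers.ABC.Multicubic.linearIndependent_prod_pow_of_cube_eq h3 α t
    (fun j => by rw [ht j, eq_ratCast]) hind

/-- **A non-zero coefficient vector has a non-zero evaluation.** [folklore] -/
theorem ev3_ne_zero (α : Fin k → ℚ)
    (hind : ∀ κ : Fin k → ℕ, (∃ j, ¬ 3 ∣ κ j) → ∀ γ : ℚ, ∏ j, α j ^ κ j ≠ γ ^ 3)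
    (t : Fin k → L) (ht : ∀ j, t j ^ 3 = (α j : L))
    {c : (Fin k → Fin 3) → ℚ} (hc : c ≠ 0) : ev3 t c ≠ 0 := by
  intro h0
  apply hc
  have hli := linearIndependent_mono3 α hind t ht
  rw [linearIndependent_iff'] at hli
  have h0' : ∑ l ∈ (univ : Finset (Fin k → Fin 3)), c l • mono3 t l = 0 := by
    rw [← h0]; unfold ev3
    refine Finset.sum_congr rfl fun l _ => ?_
    rw [Rat.smul_def]
  funext l
  exact hli univ c h0' l (Finset.mem_univ l)

/-! ### Splitting off the last root -/

/-- The first `k` roots. [folklore] -/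
abbrev init3 (t : Fin (k + 1) → L) : Fin k → L := fun j => t (Fin.castSucc j)

/-- The `r`-th slice of a coefficient vector over `k + 1` roots: the coefficients of the monomials
with last exponent `r`. [folklore] -/
def slice (c : (Fin (k + 1) → Fin 3) → ℚ) (r : Fin 3) : (Fin k → Fin 3) → ℚ :=
  fun l => c (Fin.snoc l r)

/-- Reassembling a vector over `k + 1` roots from three vectors over `k` roots. [folklore] -/
def glue (d : Fin 3 → (Fin k → Fin 3) → ℚ) : (Fin (k + 1) → Fin 3) → ℚ :=
  fun l => d (l (Fin.last k)) (Fin.init l)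

/-- Slicing a glued vector returns the pieces. [folklore] -/
@[simp] theorem slice_glue (d : Fin 3 → (Fin k → Fin 3) → ℚ) (r : Fin 3) :
    slice (glue d) r = d r := by
  funext l
  simp [slice, glue]

/-- Gluing the slices returns the vector. [folklore] -/
theorem glue_slice (c : (Fin (k + 1) → Fin 3) → ℚ) : glue (fun r => slice c r) = c := by
  funext l
  simp [slice, glue, Fin.snoc_init_self]

/-- A vector vanishes iff all its slices vanish. [folklore] -/
theorem slice_eq_zero_iff (c : (Fin (k + 1) → Fin 3) → ℚ) : (∀ r, slice c r = 0) ↔ c = 0 := by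
  constructor
  · intro h
    rw [← glue_slice c]
    funext l
    simp only [glue, h, Pi.zero_apply]
  · rintro rfl
    intro r; rfl

omit [CharZero L] in
/-- Monomials with a prescribed last exponent: `mono3 (snoc l r) = mono3 (init) l · t_k^r`. [folklore] -/
theorem mono3_snoc (t : Fin (k + 1) → L) (l : Fin k → Fin 3) (r : Fin 3) :
    mono3 t (Fin.snoc l r) = mono3 (init3 t) l * t (Fin.last k) ^ (r : ℕ) := by
  unfold mono3 init3
  rw [Fin.prod_univ_castSucc]
  simp only [Fin.snoc_castSucc, Fin.snoc_last]

omit [CharZero L] in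
/-- **`ev3 t c = ∑_r t_k^r · ev3 (init3 t) (slice c r)`**, i.e.
`= A + t_k B + t_k² C` with `A, B, C` the evaluations of the three slices. [folklore] -/
theorem ev3_succ (t : Fin (k + 1) → L) (c : (Fin (k + 1) → Fin 3) → ℚ) :
    ev3 t c = ev3 (init3 t) (slice c 0) + t (Fin.last k) * ev3 (init3 t) (slice c 1) +
      t (Fin.last k) ^ 2 * ev3 (init3 t) (slice c 2) := by
  unfold ev3
  rw [← (Fin.snocEquiv fun _ : Fin (k + 1) => Fin 3).sum_comp, Fintype.sum_prod_type,
    Fin.sum_univ_three]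
  have hsn : ∀ (r : Fin 3) (l : Fin k → Fin 3),
      (Fin.snocEquiv fun _ : Fin (k + 1) => Fin 3) (r, l) = Fin.snoc l r := fun r l => rfl
  simp only [hsn, mono3_snoc, slice, Finset.mul_sum, Fin.val_zero, Fin.val_one, Fin.val_two,
    pow_zero, pow_one, mul_one]
  refine congrArg₂ _ (congrArg₂ _ rfl ?_) ?_ <;>
    exact Finset.sum_congr rfl fun l _ => by ring


/-! ### Restricting the Kummer hypothesis and the sizes to the first `k` generators -/

/-- The first `k` generators. [folklore] -/
abbrev initα (α' : Fin (k + 1) → ℚ) : Fin k → ℚ := fun j => α' (Fin.castSucc j)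

omit [CharZero L] in
/-- The first `k` roots cube to the first `k` generators. [folklore] -/
theorem init3_pow_three (α' : Fin (k + 1) → ℚ) (t : Fin (k + 1) → L)
    (ht : ∀ j, t j ^ 3 = (α' j : L)) (j : Fin k) : init3 t j ^ 3 = (initα α' j : L) := ht _

/-- The `3`-Kummer hypothesis for `α₀, …, αₖ` implies it for `α₀, …, α_{k-1}`. [folklore] -/
theorem hind_init {α' : Fin (k + 1) → ℚ}
    (hind : ∀ κ : Fin (k + 1) → ℕ, (∃ j, ¬ 3 ∣ κ j) → ∀ γ : ℚ, ∏ j, α' j ^ κ j ≠ γ ^ 3) :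
    ∀ κ : Fin k → ℕ, (∃ j, ¬ 3 ∣ κ j) → ∀ γ : ℚ, ∏ j, initα α' j ^ κ j ≠ γ ^ 3 := by
  rintro κ ⟨j, hj⟩ γ hγ
  refine hind (Fin.snoc κ 0) ⟨Fin.castSucc j, by simpa using hj⟩ γ ?_
  rw [Fin.prod_univ_castSucc]
  simp only [Fin.snoc_castSucc, Fin.snoc_last, pow_zero, mul_one]
  exact hγ

/-- The `ℓ¹`-norm of a slice is at most that of the vector. [folklore] -/
theorem sum_abs_slice_le (c : (Fin (k + 1) → Fin 3) → ℚ) (r : Fin 3) :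
    ∑ l, |(slice c r l : ℝ)| ≤ ∑ l', |(c l' : ℝ)| := by
  rw [← (Fin.snocEquiv fun _ : Fin (k + 1) => Fin 3).sum_comp, Fintype.sum_prod_type]
  have hsn : ∀ (r : Fin 3) (l : Fin k → Fin 3),
      (Fin.snocEquiv fun _ : Fin (k + 1) => Fin 3) (r, l) = Fin.snoc l r := fun r l => rfl
  simp only [hsn]
  have : ∑ l, |(slice c r l : ℝ)| = ∑ l : Fin k → Fin 3, |(c (Fin.snoc l r) : ℝ)| := rfl
  rw [this]
  exact Finset.single_le_sum (f := fun r' => ∑ l : Fin k → Fin 3, |(c (Fin.snoc l r') : ℝ)|)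
    (fun r' _ => Finset.sum_nonneg fun l _ => abs_nonneg _) (Finset.mem_univ r)

/-- Slices keep the denominator. [folklore] -/
theorem slice_den (c : (Fin (k + 1) → Fin 3) → ℚ) {D : ℕ} (hc : ∀ l', ∃ z : ℤ, (D : ℚ) * c l' = z)
    (r : Fin 3) (l : Fin k → Fin 3) : ∃ z : ℤ, (D : ℚ) * slice c r l = z := hc _

/-- A non-zero vector has a non-zero slice. [folklore] -/
theorem slice_ne_zero_of_ne_zero {c : (Fin (k + 1) → Fin 3) → ℚ} (hc : c ≠ 0) :
    ∃ r, slice c r ≠ 0 := by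
  by_contra h
  exact hc ((slice_eq_zero_iff c).mp fun r => not_not.mp (not_exists.mp h r))

/-! ### Sizes and denominators of convolution products (integer generators) -/

/-- `|∏ⱼ αⱼ^{carryⱼ}| ≤ ∏ⱼ max(1, |αⱼ|)` since every carry is `0` or `1`. [folklore] -/
theorem abs_prod_pow_carry_le (α : Fin k → ℚ) (l l' : Fin k → Fin 3) :
    |((∏ j, α j ^ carry l l' j : ℚ) : ℝ)| ≤ ∏ j, max 1 |(α j : ℝ)| := by
  push_cast
  rw [Finset.abs_prod]
  refine Finset.prod_le_prod (fun j _ => abs_nonneg _) fun j _ => ?_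
  rw [abs_pow]
  rcases Nat.le_one_iff_eq_zero_or_eq_one.mp (carry_le_one l l' j) with h | h
  · rw [h, pow_zero]; exact le_max_left _ _
  · rw [h, pow_one]; exact le_max_right _ _

/-- **`ℓ¹`-norm of a convolution product**: `∑ |(c*d)_l| ≤ (∏ⱼ max(1,|αⱼ|)) (∑|c|)(∑|d|)`. [folklore] -/
theorem l1_cmul3_le (α : Fin k → ℚ) (c d : (Fin k → Fin 3) → ℚ) :
    ∑ l'', |(cmul3 α c d l'' : ℝ)| ≤
      (∏ j, max 1 |(α j : ℝ)|) * ((∑ l, |(c l : ℝ)|) * ∑ l', |(d l' : ℝ)|) := by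
  classical
  unfold cmul3
  calc ∑ l'', |((∑ l, ∑ l', (if l + l' = l'' then (∏ j, α j ^ carry l l' j) * (c l * d l') else 0)
        : ℚ) : ℝ)|
      ≤ ∑ l'', ∑ l, ∑ l', |((if l + l' = l'' then (∏ j, α j ^ carry l l' j) * (c l * d l') else 0
        : ℚ) : ℝ)| := by
        refine Finset.sum_le_sum fun l'' _ => ?_
        push_cast
        refine (Finset.abs_sum_le_sum_abs _ _).trans (Finset.sum_le_sum fun l _ => ?_)
        exact Finset.abs_sum_le_sum_abs _ _
    _ = ∑ l, ∑ l', |((∏ j, α j ^ carry l l' j : ℚ) : ℝ)| * (|(c l : ℝ)| * |(d l' : ℝ)|) := by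
        rw [Finset.sum_comm]
        refine Finset.sum_congr rfl fun l _ => ?_
        rw [Finset.sum_comm]
        refine Finset.sum_congr rfl fun l' _ => ?_
        rw [Finset.sum_eq_single (l + l')]
        · rw [if_pos rfl]; push_cast; rw [abs_mul, abs_mul]
        · intro l'' _ h; rw [if_neg (Ne.symm h)]; simp
        · intro h; exact absurd (Finset.mem_univ _) h
    _ ≤ ∑ l, ∑ l', (∏ j, max 1 |(α j : ℝ)|) * (|(c l : ℝ)| * |(d l' : ℝ)|) := by
        refine Finset.sum_le_sum fun l _ => Finset.sum_le_sum fun l' _ => ?_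
        exact mul_le_mul_of_nonneg_right (abs_prod_pow_carry_le α l l') (by positivity)
    _ = (∏ j, max 1 |(α j : ℝ)|) * ((∑ l, |(c l : ℝ)|) * ∑ l', |(d l' : ℝ)|) := by
        rw [Finset.sum_mul_sum, Finset.mul_sum]
        refine Finset.sum_congr rfl fun l _ => ?_
        rw [Finset.mul_sum]

/-- **Denominators of a convolution product** (integer generators): if `Dc · c ∈ ℤ`, `Dd · d ∈ ℤ`
and `αⱼ ∈ ℤ`, then `(Dc Dd) · (c*d) ∈ ℤ`. [folklore] -/
theorem exists_int_cmul3 (α : Fin k → ℚ) (hα : ∀ j, ∃ a : ℤ, α j = a)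
    (c d : (Fin k → Fin 3) → ℚ) {Dc Dd : ℕ}
    (hc : ∀ l, ∃ z : ℤ, (Dc : ℚ) * c l = z) (hd : ∀ l', ∃ z : ℤ, (Dd : ℚ) * d l' = z)
    (l'' : Fin k → Fin 3) :
    ∃ z : ℤ, ((Dc * Dd : ℕ) : ℚ) * cmul3 α c d l'' = z := by
  classical
  choose a ha using hα
  choose zc hzc using hc
  choose zd hzd using hd
  refine ⟨∑ l, ∑ l', if l + l' = l'' then (∏ j, a j ^ carry l l' j) * (zc l * zd l') else 0, ?_⟩
  unfold cmul3
  rw [Finset.mul_sum]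
  push_cast
  refine Finset.sum_congr rfl fun l _ => ?_
  rw [Finset.mul_sum]
  refine Finset.sum_congr rfl fun l' _ => ?_
  split_ifs
  · rw [← hzc l, ← hzd l']
    simp only [ha]
    ring
  · simp

end Multicub

end Summit.ABC.StewartYu

end
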